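import Summits.BirchSwinnertonDyer.BirchSwinnertonDyer.Theorems.KolyvaginRoadThreePairConsumer
import Summits.BirchSwinnertonDyer.BirchSwinnertonDyer.Theorems.KolyvaginRoadThreeCruxIffLowerHalf
import Summits.BirchSwinnertonDyer.BirchSwinnertonDyer.Theorems.Rank1ResidualIntModelReduction
import Summits.BirchSwinnertonDyer.Rank1Residual.Additive.IntModelTamagawaCertificate
import Literature.NumberTheory.EllipticCurves.PointCountEulerCriterion
import HarnessLib

/-!
# Route `KolyvaginRoadThree`, deciding crux `ZhangSharpFrameAtThreeHL` (item stmt-BirchSwinnertonDyer-19574):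
# a SPLIT-at-3 Kolyvagin-certificate rung — Cremona 5709e1 ⊗ ℚ(√−83), ℓ = 2 — modulo the published inputs and
# ONE attested certificate (cell `bsd-stepL`, seat `bsd-stepL-zhang3-p1` g6; `--supports stmt-BirchSwinnertonDyer-19574`,
# helper; planner g26 hand 2026-08-26T17:17:11Z (3)(c) / 17:22:13Z «a Heegner-index certificate at a split-3 X11b pair»)

HONEST FRAMING. BSD is not proved by any of this; a rung is ONE curve and closes nothing; Kolyvagin's conjecture mod 3
(the crux) is asserted nowhere. THEOREMS ONLY (0 defs, 0 named facts, 0 `sorry`).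

WHY THIS PAIR. The registered BC5 rung of the crux, `stub_rung_347253a1`, sits at a NON-split `3`, where the crux's
instance is ALSO reachable from published inputs plus a kernel regulator row (koly3b p456367
`Rung347253a1.rung_347253a1_of_published`, road (a) `bsdp_of_ram_of_nonsplit_of_regulatorNonvanishing`): inside S's
proved regime in the tribunal's sense. At a SPLIT `3` no in-tree road closes the crux from PUB and a kernel row
(road (a) is non-split only; the split-`3` `3`-part of BSD runs through K2@3's open halves), so a Kolyvagin certificate
there exercises exactly the Kolyvagin lever. The planner's candidate split rows (111930bc1, 103530o1, 66990u1, 66990bk1;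
all with `2 ∣ N`, hence `d_K ≡ 1 (mod 24)`, `h(d_K) ≥ 3`, Kolyvagin prime `ℓ ≥ 5`) have no affordable Heegner field ×
Kolyvagin prime (cheapest ring-class degree `[K[ℓ]:ℚ]` over `|d_K| < 2000`: 5 508 / — / 3 444 / 1 476; koly's engine
ceiling is ≈ 36), and koly's TRUE-OPEN scan j249386 found no split-at-3 row of the right type at degree `≤ 36`. But
koly's class-wide certificate table `KOLY-WITNESS.md` (v5) ALREADY contains split-at-3 A1 pairs, among them — with
`N ≥ 5000`, outside the printed range of verified BSD — **5709e1 = `[0, 1, 1, −107, 392]` ⊗ ℚ(√−83), ℓ = 2** (kit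
j250992, `koly/kit-g9/certs/cert_5709e1_d83_l2_j250992.txt`: `y_K ∈ 3·E(K)`, the balanced derived point `P(2)` is
NOT `3`-divisible in `E(K[2])`, `[K[2]:ℚ] = 18`, EXACT arithmetic on the recognised algebraic point, `E(K[2])_tors = 1`
⇒ `c₁(2) ≢ 0 (mod 3)`). This file is that certificate's Lean reading, in the shape of zhang3-p1 g4's
`KolyvaginRoadThreeRung347253a1.lean`.

WHAT IS KERNEL HERE (more than in the 347253a1 file): for ANY globally minimal `W = [0,1,1,−107,392]`, §0 proves in
the kernel `Δ = 5709 = 3·11·173`, `c₄ = 5152 = 2⁵·7·23`, multiplicative AND SPLIT at `3` (node-tangent quadratic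
`≡ T² − 1 (mod 3)`, root `T = 1`), the (ram) witness `ℓ = 11` (`11 ∥ Δ`), `E[3]` irreducible (Frobenius witness at
`17`: `#Ẽ(𝔽₁₇) = 10`, `a₁₇ = 8`, `X² − 8X + 17` root-free mod `3`), hence `ρ̄_{E,3}` onto (`surj_of_irr_of_ram`),
`∏_ℓ c_ℓ = 1` (Tate's algorithm as a kernel row certificate: `I₁` split at `3`, `I₁` non-split at `11`, `I₁` split at
`173`), and `a₂ = 0` (`#Ẽ(𝔽₂) = 3`; with `−83 ≡ 5 (mod 8)` the prime `2` is inert in `ℚ(√−83)` and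
`a₂ ≡ 2 + 1 ≡ 0 (mod 3)`: Gross's congruences (3.3) for the Kolyvagin prime `ℓ = 2` at `p = 3`). So of the crux's
curve-level binders only `analyticRank W = 1` remains a hypothesis (`ClassX11b W 3` is assembled from it). WHAT IS NOT
KERNEL: the certificate itself — the datum's `map_y` ties `y(2)` to the ANALYTIC parametrisation and
`IsKolyvaginPrime … 2` contains Gross's (3.2) `FrobEqFrobInfty`, neither of which the tree can produce — carried as
explicit ATTESTED hypotheses exactly as in the 347253a1 file.

PARTITION: O2@3 (B10) × A1 ∩ SPLIT(3) (class-wide; the one class 5709e1, NOT a TRUE-OPEN row) — types-the-object-of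
(a rung decl for the planner's option (c) on the route's `tribunal_fit.witness`); closes: none (T7).

* §0 `Rung5709e1.Δ_eq`, `c₄_eq`, `integralModelInt_eq`, `hasMultiplicativeReductionAtPrime_three`,
  `hasSplitMultiplicativeReductionAtPrime_three`, `ram_three`, `card_mod_seventeen`, `irr_three`, `surj_three`,
  `classX11b_three_of_analyticRank`, `rowCheck_tam`, `tamagawaProduct_eq_one`, `card_mod_two`, `frobeniusTrace_two`;
* §1 `Rung5709e1.bsdp_of_cert` — the pair's leaf `BSDp W 3` from PUB + the certificate package (p433031 instantiated);
* §2 `Rung5709e1.rung_5709e1_of_cert` — the crux's conclusion at EVERY Hoffstein–Luo frame of the curve from PUB +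
  the certificate package; `Rung5709e1.stub_rung_5709e1_of_cert` — the same in the EXACT shape of the registered
  `stub_rung_347253a1` (curve-level binders inside the conclusion, field pinned by `d_K = −83`), registrable verbatim;
* §3 `Rung5709e1.rung_5709e1_of_shaAn_unit` — the same conclusion from PUB + `#Ш(E)_an` a `3`-adic unit (E-K6 currency;
  the pair has `#Ш(E)_an = 1`, `#Ш(E^{(−83)})_an = 36`), independent of the Heegner-point computation.

References (locators only): [cite: GrossLMS1991, §3 (3.1)–(3.3), §4 (4.1)] [cite: McCallumLMS1991, §4 Cor. 4.5,
§5 Cor. 5.6] [cite: WZhang2014, Remark 5 and Thm. 10.2] [cite: SilvermanAEC2009, VII.5 Prop. 5.1] [cite: Mazur1978,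
§6 Prop. 6.3 (1)] [cite: SilvermanATAEC1994, IV.9.4] [cite: Cremona1997, Table 1 (5709e1)]. -/

noncomputable section

open scoped Classical

namespace Summit.BirchSwinnertonDyer.Rank1Residual.X11b.Three.Koly.Rung5709e1

open WeierstrassCurve NumberField Literature.NumberTheory.EllipticCurves
  Literature.NumberTheory.EllipticCurves.ModularForms
  Literature.NumberTheory.EllipticCurves.Rank1Residual
  Literature.NumberTheory.EllipticCurves.Rank1Residual.Typed
  Summit.BirchSwinnertonDyer.Rank1Residual Summit.BirchSwinnertonDyer.Rank1Residual.X11b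
  Summit.BirchSwinnertonDyer.Rank1Residual.X11b.Three.Koly
  Summit.BirchSwinnertonDyer.BirchSwinnertonDyer.Rank1Residual
  Summit.BirchSwinnertonDyer.BirchSwinnertonDyer.Rank2Observatory.Tam
  Summit.BirchSwinnertonDyer.Rank1Residual.Additive.IntModelTam

/-! ## §0 Kernel-checked invariants of the model `[0, 1, 1, −107, 392]` (Cremona 5709e1 = LMFDB 5709.?; N = 5709) -/

/-- `Δ = 5709 = 3 · 11 · 173` for `⟨0,1,1,−107,392⟩` (square-free: `I₁` at every bad prime). Kernel arithmetic.
[folklore] -/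
theorem Δ_eq (W : WeierstrassCurve ℚ) (hW : W = ⟨0, 1, 1, -107, 392⟩) :
    W.Δ = 5709 ∧ (5709 : ℤ) = 3 * 11 * 173 := by
  subst hW
  refine ⟨?_, by norm_num⟩
  norm_num [WeierstrassCurve.Δ, WeierstrassCurve.b₂, WeierstrassCurve.b₄, WeierstrassCurve.b₆, WeierstrassCurve.b₈]

/-- `c₄ = 5152 = 2⁵ · 7 · 23` (prime to `3`, `11`, `173`: multiplicative at every bad prime) and `c₆ = −369784` for
`⟨0,1,1,−107,392⟩`. Kernel arithmetic. [folklore] -/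
theorem c₄_eq (W : WeierstrassCurve ℚ) (hW : W = ⟨0, 1, 1, -107, 392⟩) :
    W.c₄ = 5152 ∧ W.c₆ = -369784 ∧ (5152 : ℤ) = 2 ^ 5 * 7 * 23 := by
  subst hW
  refine ⟨?_, ?_, by norm_num⟩
  · norm_num [WeierstrassCurve.c₄, WeierstrassCurve.b₂, WeierstrassCurve.b₄]
  · norm_num [WeierstrassCurve.c₆, WeierstrassCurve.b₂, WeierstrassCurve.b₄, WeierstrassCurve.b₆]

/-- The integral model of a globally minimal `W = ⟨0,1,1,−107,392⟩` is `[0, 1, 1, −107, 392]`. [folklore] -/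
theorem integralModelInt_eq (W : WeierstrassCurve ℚ) (hW : W = ⟨0, 1, 1, -107, 392⟩) [W.IsGloballyMinimal] :
    integralModelInt W = (⟨0, 1, 1, -107, 392⟩ : WeierstrassCurve ℤ) :=
  IntModel.integralModelInt_eq_of_map_eq _ (by rw [hW]; ext <;> simp [WeierstrassCurve.map])

/-- `Δ = 5709` on the integer model. Kernel arithmetic. [folklore] -/
theorem intΔ_eq : (⟨0, 1, 1, -107, 392⟩ : WeierstrassCurve ℤ).Δ = 5709 := by
  norm_num [WeierstrassCurve.Δ, WeierstrassCurve.b₂, WeierstrassCurve.b₄, WeierstrassCurve.b₆, WeierstrassCurve.b₈]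

/-- `c₄ = 5152` on the integer model. Kernel arithmetic. [folklore] -/
theorem intc₄_eq : (⟨0, 1, 1, -107, 392⟩ : WeierstrassCurve ℤ).c₄ = 5152 := by
  norm_num [WeierstrassCurve.c₄, WeierstrassCurve.b₂, WeierstrassCurve.b₄]

/-- **Multiplicative at `3`** (`3 ∣ Δ = 5709`, `3 ∤ c₄ = 5152`; Silverman VII.5.1(b)). [cite: SilvermanAEC2009, VII.5 Prop. 5.1(b)] -/
theorem hasMultiplicativeReductionAtPrime_three (W : WeierstrassCurve ℚ) (hW : W = ⟨0, 1, 1, -107, 392⟩)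
    [W.IsElliptic] [W.IsGloballyMinimal] : W.HasMultiplicativeReductionAtPrime 3 :=
  IntModel.hasMultiplicativeReductionAtPrime_of_intModel (integralModelInt_eq W hW) 3
    (by rw [intΔ_eq]; norm_num) (by rw [intc₄_eq]; norm_num)

/-- **SPLIT multiplicative at `3`**: the node-tangent quadratic `c₄T² + a₁c₄T − (54b₆ − 3b₂b₄ + a₂c₄) =
5152·T² − 92446 ≡ T² − 1 (mod 3)` has the root `T = 1` (Silverman VII.5.1(b); tree
`IntModel.hasSplitMultiplicativeReductionAtPrime_of_intModel_of_root`). So `a₃ = +1`: the pair sits on the SPLIT half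
of the crux, where road (a) of the non-split reduction does not reach. [cite: SilvermanAEC2009, VII.5 Prop. 5.1(b)] -/
theorem hasSplitMultiplicativeReductionAtPrime_three (W : WeierstrassCurve ℚ) (hW : W = ⟨0, 1, 1, -107, 392⟩)
    [W.IsElliptic] [W.IsGloballyMinimal] : W.HasSplitMultiplicativeReductionAtPrime 3 := by
  refine IntModel.hasSplitMultiplicativeReductionAtPrime_of_intModel_of_root (integralModelInt_eq W hW) 3
    (by rw [intΔ_eq]; norm_num) (by rw [intc₄_eq]; norm_num) ⟨1, ?_⟩
  have hb₂ : (⟨0, 1, 1, -107, 392⟩ : WeierstrassCurve ℤ).b₂ = 4 := by norm_num [WeierstrassCurve.b₂]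
  have hb₄ : (⟨0, 1, 1, -107, 392⟩ : WeierstrassCurve ℤ).b₄ = -214 := by norm_num [WeierstrassCurve.b₄]
  have hb₆ : (⟨0, 1, 1, -107, 392⟩ : WeierstrassCurve ℤ).b₆ = 1569 := by norm_num [WeierstrassCurve.b₆]
  rw [intc₄_eq, hb₂, hb₄, hb₆]
  decide

/-- **The (ram) witness `ℓ = 11`**: multiplicative at `11` (`11 ∣ Δ`, `11 ∤ c₄`) with `11¹ ∥ Δ = Δ_min` and `3 ∤ 1`.
[cite: SkinnerUrban2014, Thm. 2 (p. 3), second bullet] [cite: SilvermanAEC2009, VII.5 Prop. 5.1(b)] -/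
theorem ram_three (W : WeierstrassCurve ℚ) (hW : W = ⟨0, 1, 1, -107, 392⟩) [W.IsElliptic] [W.IsGloballyMinimal] :
    Ram W 3 :=
  IntModel.ram_of_intModel (integralModelInt_eq W hW) 3 11 (by norm_num) (by norm_num)
    (by rw [intΔ_eq]; norm_num) (by rw [intc₄_eq]; norm_num) (e := 1) (by rw [intΔ_eq]; norm_num)
    (by rw [intΔ_eq]; norm_num) (by norm_num)

/-- `#Ẽ(𝔽₁₇) = 10` for `[0, 1, 1, −107, 392]` (`a₁₇ = 8`). Kernel-decided. [folklore] -/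
theorem card_mod_seventeen :
    Nat.card (((⟨0, 1, 1, -107, 392⟩ : WeierstrassCurve ℤ).map
      (Int.castRingHom (ZMod 17))).toAffine.Point) = 10 := by
  rw [@WeierstrassCurve.natCard_point_eq_one_add_card (ZMod 17) (@ZMod.instField 17 ⟨by norm_num⟩)
    _ _ _ (by decide +kernel), @card_sol_eq_sum_euler (ZMod 17) (@ZMod.instField 17 ⟨by norm_num⟩)
    _ _ (by rw [ZMod.ringChar_zmod_n]; decide), ZMod.card]
  decide +kernel

/-- **`E[3]` is irreducible** — Frobenius witness at the good prime `17` (`17 ∤ Δ`): `#Ẽ(𝔽₁₇) = 10`, `a₁₇ = 8`, and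
`X² − 8X + 17 ≡ X² + X + 2` has no root mod `3` (Mazur 1978 Prop. 6.3 (1); tree
`IntModel.hasIrreducibleModPGaloisRep_of_intModel_of_noroot`). [cite: Mazur1978, §5 (p. 148) and §6 Prop. 6.3 (1) (p. 153)] -/
theorem irr_three (W : WeierstrassCurve ℚ) (hW : W = ⟨0, 1, 1, -107, 392⟩) [W.IsElliptic] [W.IsGloballyMinimal] :
    Irr W 3 :=
  haveI : Fact (Nat.Prime 17) := ⟨by norm_num⟩
  IntModel.hasIrreducibleModPGaloisRep_of_intModel_of_noroot (integralModelInt_eq W hW) 3 17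
    (by norm_num) (by rw [intΔ_eq]; norm_num) card_mod_seventeen (by decide)

/-- **`ρ̄_{E,3}` is onto `GL₂(𝔽₃)`** — irreducible + a (ram) prime (Serre's inertia argument; tree
`surj_of_irr_of_ram`). [cite: Serre1972, §2.4 Prop. 15] -/
theorem surj_three (W : WeierstrassCurve ℚ) (hW : W = ⟨0, 1, 1, -107, 392⟩) [W.IsElliptic] [W.IsGloballyMinimal] :
    Surj W 3 :=
  surj_of_irr_of_ram W 3 (irr_three W hW) (ram_three W hW)

/-- `(5709e1, 3) ∈ X11b` GIVEN analytic rank `1` (the one curve-level binder the kernel cannot discharge):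
`ClassX11b W 3 = (r_an = 1) ∧ 3 ≠ 2 ∧ Mult W 3 ∧ Irr W 3`. [folklore] -/
theorem classX11b_three_of_analyticRank (W : WeierstrassCurve ℚ) (hW : W = ⟨0, 1, 1, -107, 392⟩) [W.IsElliptic]
    [W.IsGloballyMinimal] (hr : W.analyticRank = 1) : ClassX11b W 3 :=
  ⟨hr, by norm_num, hasMultiplicativeReductionAtPrime_three W hW, irr_three W hW⟩

/-- **Tate's algorithm as a kernel row certificate** for `[0,1,1,−107,392]` (`|Δ| = 3·11·173`): `I₁` SPLIT at `3`
(node-tangent root `1`, `c₃ = 1`), `I₁` NON-split at `11` (no root by exhaustion, `c₁₁ = 1`), `I₁` split at `173`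
(root `12`, `c₁₇₃ = 1`); format of the rank-2 observatory's `TamLocal` (p, ⌊√p⌋, kind, w, r, s, t, n, exit, k, c).
Kernel-decided. [cite: SilvermanATAEC1994, IV.9.4] -/
theorem rowCheck_tam :
    TamLocal.rowCheck [⟨3, 1, 1, 1, 0, 0, 0, 1, 0, 0, 1⟩, ⟨11, 3, 2, 0, 0, 0, 0, 1, 0, 0, 1⟩,
        ⟨173, 13, 1, 12, 0, 0, 0, 1, 0, 0, 1⟩] ⟨0, 1, 1, -107, 392⟩ = true := by
  decide +kernel

/-- **`∏_ℓ c_ℓ(5709e1) = 1` IN THE KERNEL** (so `3 ∤ ∏ c_ℓ`: the A1 binder of the crux discharged for this curve).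
[cite: SilvermanATAEC1994, IV.9.4] -/
theorem tamagawaProduct_eq_one (W : WeierstrassCurve ℚ) (hW : W = ⟨0, 1, 1, -107, 392⟩) [W.IsGloballyMinimal] :
    W.tamagawaProduct = 1 := by
  have h := tamagawaProduct_mem_rowVals_of_intModel (integralModelInt_eq W hW) rowCheck_tam
  have hv : TamLocal.rowVals [⟨3, 1, 1, 1, 0, 0, 0, 1, 0, 0, 1⟩, ⟨11, 3, 2, 0, 0, 0, 0, 1, 0, 0, 1⟩,
      ⟨173, 13, 1, 12, 0, 0, 0, 1, 0, 0, 1⟩] = [1] := by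
    decide +kernel
  rw [hv] at h
  simpa using h

/-- `#Ẽ(𝔽₂) = 3` for `[0, 1, 1, −107, 392]` (`y² + y = x³ + x² + x` over `𝔽₂`: `O`, `(0,0)`, `(0,1)`). Kernel-decided.
[folklore] -/
theorem card_mod_two :
    Nat.card (((⟨0, 1, 1, -107, 392⟩ : WeierstrassCurve ℤ).map
      (Int.castRingHom (ZMod 2))).toAffine.Point) = 3 := by
  rw [@WeierstrassCurve.natCard_point_eq_one_add_card (ZMod 2) (@ZMod.instField 2 ⟨by norm_num⟩)
    _ _ _ (by decide +kernel)]
  decide +kernel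

/-- **`a₂ = 0`** for the globally minimal `W = ⟨0,1,1,−107,392⟩` (`#Ẽ(𝔽₂) = 3`), so `a₂ ≡ 2 + 1 ≡ 0 (mod 3)`; with
`−83 ≡ 5 (mod 8)` (`2` inert in `ℚ(√−83)`) these are Gross's congruences (3.3) for the Kolyvagin prime `ℓ = 2` of
`(E, ℚ(√−83), 3)`. (The tree's `IsKolyvaginPrime … 2` also contains the Galois statement (3.2), not produced here.)
[cite: GrossLMS1991, §3 (3.3)] -/
theorem frobeniusTrace_two (W : WeierstrassCurve ℚ) (hW : W = ⟨0, 1, 1, -107, 392⟩) [W.IsElliptic]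
    [W.IsGloballyMinimal] :
    W.frobeniusTrace 2 = 0 ∧ ((2 : ℤ) + 1) % 3 = 0 ∧ (-83 : ℤ) % 8 = 5 := by
  refine ⟨?_, by decide, by decide⟩
  haveI : Fact (Nat.Prime 2) := ⟨Nat.prime_two⟩
  have h := IntModel.frobeniusTrace_eq (integralModelInt_eq W hW) card_mod_two
  rw [h]; norm_num

/-! ## §1 The pair's leaf from the certificate package -/

/-- **`BSD(5709e1, 3)` from ONE Kolyvagin certificate at a SPLIT `3`** — zhang3-p1 g3's per-pair consumer
`Koly.bsdp_three_of_not_pDiv_at_hlFrame` (p433031) AT `W = ⟨0,1,1,−107,392⟩`: the certificate package is a field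
`K₀` with `d_{K₀} = −83` (imaginary quadratic, `h = 3`, Heegner for `N = 3·11·173`, `L(E^{(−83)},1) ≠ 0`:
`#Ш(E^{(−83)})_an = 36`), a Manin-good frame `(Dt₀, β₀, ι₀)`, the Kolyvagin prime `ℓ = 2` for `(E, K₀, 3)` and a
Kolyvagin–Heegner datum `d₀` of conductor `2` whose derived point `P(2)` is NOT `3`-divisible in `E(K₀[2])` — the
content of koly's kit certificate j250992 (`cert_5709e1_d83_l2_j250992.txt`: degree-18 ring class field, balanced
weights, PREC 1000, exact `ellisdivisible = 0`, no `K₀[2]`-rational root of `φ₃ − x(P)ψ₃²`, `E(K₀[2])_tors = 1`),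
carried as HYPOTHESES (attested, not kernel-checked). PUBLISHED inputs as binders; of the curve-level binders only
`r_an = 1` remains (§0 discharges Mult/Irr/Ram/Surj/`∏c = 1`). CONDITIONAL on every binder; nothing is booked.
[cite: McCallumLMS1991, §4 Cor. 4.5 and §5 Cor. 5.6] [cite: GrossLMS1991, §3, Prop. 3.6, §4 (4.1)] -/
theorem bsdp_of_cert (W : WeierstrassCurve ℚ) (hW : W = ⟨0, 1, 1, -107, 392⟩)
    [W.IsElliptic] [W.IsGloballyMinimal] [NeZero (W.conductorNorm ℤ)]
    -- published inputs (named facts of the tree)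
    (hGZ : ∀ (K : Type) [Field K] [NumberField K], gross_zagier (W.conductorNorm ℤ) W K)
    (hKo : ∀ (K : Type) [Field K] [NumberField K], kolyvagin (W.conductorNorm ℤ) W K)
    (hB : ∀ (K : Type) [Field K] [NumberField K], Kolyvagin1990_padicValNat_card_sha_le (W.conductorNorm ℤ) W K)
    (hSk : Skinner2016.thmC_padicValRat_bsd_rank_zero)
    (hGZK : rank_eq_analyticRank_of_analyticRank_le_one) (hmod : hasEntireLFunction_rat)
    (hrec : ∀ (K : Type) [Field K] [NumberField K], heegnerPointOfConductor_one_galoisConj (W.conductorNorm ℤ) W K)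
    (h1 : ∀ (K : Type) [Field K] [NumberField K],
      phi_heegnerPointOfConductor_mem_range_map_ringClassField (W.conductorNorm ℤ) W K)
    (h2 : ∀ (K : Type) [Field K] [NumberField K], exists_generator_ringClassGalOver K)
    (hMc : McCallum1991_pow_dvd_card_sha_primary_of_certificate)
    -- the pair: analytic rank one (the only curve-level binder left)
    (hr : W.analyticRank = 1)
    -- THE CERTIFICATE PACKAGE (attested): one frame of a field with d_K = −83, ℓ = 2, P(2) ∉ 3·E(K₀[2])
    (K₀ : Type) [Field K₀] [NumberField K₀]
    (Dt₀ : ModularParametrizationData W (W.conductorNorm ℤ)) (β₀ : ℤ) (ι₀ : K₀ →+* ℂ)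
    (hK₀ : IsImaginaryQuadratic K₀) (hd₀ : NumberField.discr K₀ = -83)
    (hH₀ : SatisfiesHeegnerHypothesis (W.conductorNorm ℤ) K₀)
    (hLt₀ : (W.quadraticTwist (NumberField.discr K₀ : ℚ)).entireLFunction 1 ≠ 0) (hc₀ : ¬ (3 : ℤ) ∣ Dt₀.c)
    (hℓ₀ : Zhang2014.IsKolyvaginPrime (W.conductorNorm ℤ) W K₀ 3 2)
    (d₀ : KolyvaginHeegnerData Dt₀ β₀ ι₀ 2) (hcert₀ : ¬ PDiv d₀ 3 1) :
    BSDp W 3 := by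
  have hodd₀ : Odd (NumberField.discr K₀) := by rw [hd₀]; decide
  have htam : ¬ 3 ∣ W.tamagawaProduct := by rw [tamagawaProduct_eq_one W hW]; decide
  exact bsdp_three_of_not_pDiv_at_hlFrame W K₀ Dt₀ β₀ ι₀ (hGZ K₀) (hKo K₀) (hB K₀) hSk hGZK hmod (hrec K₀) (h1 K₀)
    (h2 K₀) hMc (classX11b_three_of_analyticRank W hW hr) (ram_three W hW) htam hK₀ hodd₀ hH₀ hLt₀ hc₀
    (KolyvaginDescent.kolSupp_prime Nat.prime_two hℓ₀) d₀ hcert₀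

/-! ## §2 The rung: the crux's conclusion at every Hoffstein–Luo frame of 5709e1 -/

/-- **The SPLIT-at-3 rung — the crux's conclusion at EVERY Hoffstein–Luo frame of 5709e1 — from the published inputs
and ONE attested Kolyvagin certificate.** For `W = ⟨0,1,1,−107,392⟩` (Cremona 5709e1, SPLIT multiplicative at `3`,
`r_an = 1` assumed): given the certificate package of §1 (kit j250992: `5709e1 ⊗ ℚ(√−83)`, `ℓ = 2`,
`P(2) ∉ 3·E(K[2])`), EVERY imaginary quadratic `K` with `d_K` odd, Heegner for `N`, `L(E^{d_K}, 1) ≠ 0`, and EVERY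
frame `(Dt, β, ι)` with `4N ∣ β² − d_K`, `3 ∤ c(Dt)` carries a Kolyvagin–Heegner datum of Kolyvagin-prime conductor with
`c₁(n) ≠ 0 in H¹(K, E[3])` — the conclusion of `ZhangSharpFrameAtThreeHL` at this curve, on its whole frame range.
Mechanism: §1 gives `BSDp W 3`; zhang3-p1 g3's converse `Koly.kolyvaginClass_one_ne_zero_of_bsdp_of_hlFrame`
(McCallum Cor. 5.6, divisibility half `hMcU`) returns a non-zero class on every HL frame
(`Koly.kolyvaginClass_one_ne_zero_allHLFrames_of_not_pDiv`, p433031). CONDITIONAL on every binder (the certificate is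
ATTESTED, not kernel-checked); nothing is booked; a T3 witness in the tribunal's sense only modulo that attestation.
[cite: McCallumLMS1991, §4 Cor. 4.5, §5 Lemma 5.1 and Cor. 5.6] [cite: WZhang2014, Remark 5 and Thm. 10.2]
[cite: GrossLMS1991, §3 (3.1)–(3.3), §4 (4.1)] -/
theorem rung_5709e1_of_cert (W : WeierstrassCurve ℚ) (hW : W = ⟨0, 1, 1, -107, 392⟩)
    [W.IsElliptic] [W.IsGloballyMinimal] [NeZero (W.conductorNorm ℤ)]
    -- published inputs (named facts of the tree)
    (hGZ : ∀ (K : Type) [Field K] [NumberField K], gross_zagier (W.conductorNorm ℤ) W K)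
    (hKo : ∀ (K : Type) [Field K] [NumberField K], kolyvagin (W.conductorNorm ℤ) W K)
    (hB : ∀ (K : Type) [Field K] [NumberField K], Kolyvagin1990_padicValNat_card_sha_le (W.conductorNorm ℤ) W K)
    (hSk : Skinner2016.thmC_padicValRat_bsd_rank_zero)
    (hGZK : rank_eq_analyticRank_of_analyticRank_le_one) (hmod : hasEntireLFunction_rat)
    (hrec : ∀ (K : Type) [Field K] [NumberField K], heegnerPointOfConductor_one_galoisConj (W.conductorNorm ℤ) W K)
    (h1 : ∀ (K : Type) [Field K] [NumberField K],
      phi_heegnerPointOfConductor_mem_range_map_ringClassField (W.conductorNorm ℤ) W K)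
    (h2 : ∀ (K : Type) [Field K] [NumberField K], exists_generator_ringClassGalOver K)
    (hMc : McCallum1991_pow_dvd_card_sha_primary_of_certificate)
    (hMcU : McCallum1991_padicValNat_card_sha_primary_add_le_of_globalDivisibility)
    -- the pair: analytic rank one
    (hr : W.analyticRank = 1)
    -- THE CERTIFICATE PACKAGE (attested): one frame of a field with d_K = −83, ℓ = 2, P(2) ∉ 3·E(K₀[2])
    (K₀ : Type) [Field K₀] [NumberField K₀]
    (Dt₀ : ModularParametrizationData W (W.conductorNorm ℤ)) (β₀ : ℤ) (ι₀ : K₀ →+* ℂ)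
    (hK₀ : IsImaginaryQuadratic K₀) (hd₀ : NumberField.discr K₀ = -83)
    (hH₀ : SatisfiesHeegnerHypothesis (W.conductorNorm ℤ) K₀)
    (hLt₀ : (W.quadraticTwist (NumberField.discr K₀ : ℚ)).entireLFunction 1 ≠ 0) (hc₀ : ¬ (3 : ℤ) ∣ Dt₀.c)
    (hℓ₀ : Zhang2014.IsKolyvaginPrime (W.conductorNorm ℤ) W K₀ 3 2)
    (d₀ : KolyvaginHeegnerData Dt₀ β₀ ι₀ 2) (hcert₀ : ¬ PDiv d₀ 3 1)
    -- ANY Hoffstein–Luo frame of the curve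
    (K : Type) [Field K] [NumberField K] (Dt : ModularParametrizationData W (W.conductorNorm ℤ)) (β : ℤ)
    (ι : K →+* ℂ) (hK : IsImaginaryQuadratic K) (hodd : Odd (NumberField.discr K))
    (hH : SatisfiesHeegnerHypothesis (W.conductorNorm ℤ) K)
    (hLt : (W.quadraticTwist (NumberField.discr K : ℚ)).entireLFunction 1 ≠ 0)
    (hβ : (4 * (W.conductorNorm ℤ : ℤ)) ∣ β ^ 2 - NumberField.discr K) (hc : ¬ (3 : ℤ) ∣ Dt.c) :
    ∃ (n : ℕ) (d : KolyvaginHeegnerData Dt β ι n),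
      KolyvaginDescent.KolSupp (Zhang2014.IsKolyvaginPrime (W.conductorNorm ℤ) W K 3) n ∧
        d.kolyvaginClass Nat.prime_three 1 ≠ 0 := by
  have hodd₀ : Odd (NumberField.discr K₀) := by rw [hd₀]; decide
  have htam : ¬ 3 ∣ W.tamagawaProduct := by rw [tamagawaProduct_eq_one W hW]; decide
  exact kolyvaginClass_one_ne_zero_allHLFrames_of_not_pDiv W hGZ hKo hB hSk hGZK hmod hrec h1 h2 hMc hMcU
    (classX11b_three_of_analyticRank W hW hr) (ram_three W hW) htam K₀ Dt₀ β₀ ι₀ hK₀ hodd₀ hH₀ hLt₀ hc₀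
    (KolyvaginDescent.kolSupp_prime Nat.prime_two hℓ₀) d₀ hcert₀ K Dt β ι hK hodd hH hLt hβ hc

/-- **The same rung in the EXACT SHAPE of the registered `stub_rung_347253a1`** (planner SkeletonHL-v3 / Method2 v2t
§4 on item 19574), with `W5709e1 := W` and the field pinned by `d_K = −83`: the curve-level binders of the crux
(`ClassX11b W 3`, multiplicative at `3`, `Surj W 3`, `Ram W 3`, `3 ∤ ∏c`) arrive INSIDE the conclusion, exactly as in
`Rung347253a1.rung_347253a1_of_cert` — so that, should the judge rule option (c) (re-seat the KOLY witness on a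
split-at-3 pair), the planner can register `stub_rung_5709e1` with this conclusion verbatim and this theorem is its
producer modulo PUB + the attested certificate. (Here `3 ∤ ∏c`, `Ram`, `Surj`, `Mult` are moreover kernel theorems of
§0, and the value `−83` of the frame field is not used.) CONDITIONAL on every binder; nothing is booked.
[cite: McCallumLMS1991, §4 Cor. 4.5, §5 Lemma 5.1 and Cor. 5.6] [cite: WZhang2014, Remark 5 and Thm. 10.2] -/
theorem stub_rung_5709e1_of_cert (W : WeierstrassCurve ℚ) (hW : W = ⟨0, 1, 1, -107, 392⟩)
    [W.IsElliptic] [W.IsGloballyMinimal] [NeZero (W.conductorNorm ℤ)]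
    -- published inputs (named facts of the tree)
    (hGZ : ∀ (K : Type) [Field K] [NumberField K], gross_zagier (W.conductorNorm ℤ) W K)
    (hKo : ∀ (K : Type) [Field K] [NumberField K], kolyvagin (W.conductorNorm ℤ) W K)
    (hB : ∀ (K : Type) [Field K] [NumberField K], Kolyvagin1990_padicValNat_card_sha_le (W.conductorNorm ℤ) W K)
    (hSk : Skinner2016.thmC_padicValRat_bsd_rank_zero)
    (hGZK : rank_eq_analyticRank_of_analyticRank_le_one) (hmod : hasEntireLFunction_rat)
    (hrec : ∀ (K : Type) [Field K] [NumberField K], heegnerPointOfConductor_one_galoisConj (W.conductorNorm ℤ) W K)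
    (h1 : ∀ (K : Type) [Field K] [NumberField K],
      phi_heegnerPointOfConductor_mem_range_map_ringClassField (W.conductorNorm ℤ) W K)
    (h2 : ∀ (K : Type) [Field K] [NumberField K], exists_generator_ringClassGalOver K)
    (hMc : McCallum1991_pow_dvd_card_sha_primary_of_certificate)
    (hMcU : McCallum1991_padicValNat_card_sha_primary_add_le_of_globalDivisibility)
    -- THE CERTIFICATE PACKAGE (attested): one frame of a field with d_K = −83, ℓ = 2, P(2) ∉ 3·E(K₀[2])
    (K₀ : Type) [Field K₀] [NumberField K₀]
    (Dt₀ : ModularParametrizationData W (W.conductorNorm ℤ)) (β₀ : ℤ) (ι₀ : K₀ →+* ℂ)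
    (hK₀ : IsImaginaryQuadratic K₀) (hd₀ : NumberField.discr K₀ = -83)
    (hH₀ : SatisfiesHeegnerHypothesis (W.conductorNorm ℤ) K₀)
    (hLt₀ : (W.quadraticTwist (NumberField.discr K₀ : ℚ)).entireLFunction 1 ≠ 0) (hc₀ : ¬ (3 : ℤ) ∣ Dt₀.c)
    (hℓ₀ : Zhang2014.IsKolyvaginPrime (W.conductorNorm ℤ) W K₀ 3 2)
    (d₀ : KolyvaginHeegnerData Dt₀ β₀ ι₀ 2) (hcert₀ : ¬ PDiv d₀ 3 1) :
    -- the shape of a registered rung `stub_rung_5709e1` (cf. `stub_rung_347253a1`, SkeletonHL-v3 on item 19574)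
    ∀ (K : Type) [Field K] [NumberField K] (Dt : ModularParametrizationData W (W.conductorNorm ℤ)) (β : ℤ)
      (ι : K →+* ℂ), ClassX11b W 3 → W.HasMultiplicativeReductionAtPrime 3 → Surj W 3 → Ram W 3 →
      ¬ 3 ∣ W.tamagawaProduct → IsImaginaryQuadratic K → Odd (NumberField.discr K) →
      SatisfiesHeegnerHypothesis (W.conductorNorm ℤ) K →
      (W.quadraticTwist (NumberField.discr K : ℚ)).entireLFunction 1 ≠ 0 → NumberField.discr K = -83 →
      (4 * (W.conductorNorm ℤ : ℤ)) ∣ β ^ 2 - NumberField.discr K → ¬ (3 : ℤ) ∣ Dt.c →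
      ∃ (n : ℕ) (d : KolyvaginHeegnerData Dt β ι n),
        KolyvaginDescent.KolSupp (Zhang2014.IsKolyvaginPrime (W.conductorNorm ℤ) W K 3) n ∧
          d.kolyvaginClass Nat.prime_three 1 ≠ 0 := by
  intro K _ _ Dt β ι hX _hmult _hsurj _hram _htam hK hodd hH hLt _hd hβ hc
  exact rung_5709e1_of_cert W hW hGZ hKo hB hSk hGZK hmod hrec h1 h2 hMc hMcU hX.1 K₀ Dt₀ β₀ ι₀ hK₀ hd₀ hH₀ hLt₀ hc₀
    hℓ₀ d₀ hcert₀ K Dt β ι hK hodd hH hLt hβ hc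

/-! ## §3 The same conclusion in E-K6 currency (no Heegner point of conductor > 1) -/

/-- **The rung from the EXACT analytic order of `Ш` instead of a Heegner-point computation.** For
`W = ⟨0,1,1,−107,392⟩` (`#Ш(E/ℚ)_an = 1` by Cremona's table / koly's scan: a pair of type `(1, 36)` at `d = −83`): if
`#Ш(E/ℚ)_an` is a rational `q` with `ord₃ q ≤ 0` (attested), then — published inputs as binders — every HL frame of
the curve carries a non-zero mod-3 Kolyvagin class, by zhang3-p1 g4's
`Koly.kolyvaginClass_one_ne_zero_of_padicValRat_shaAn_le_zero_of_hlFrame` (p441688: the lower half is empty, the upper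
half is Kolyvagin + Skinner C, and `BSDp` forces the class). Independent of §1's certificate; equally NOT
kernel-checked; recorded so that both attested currencies of this split-at-3 pair are on file. CONDITIONAL on every
binder; nothing is booked. [cite: WZhang2014, Remark 5 and Thm. 10.2] [cite: Miller2011LMS, Def. 1.1]
[cite: McCallumLMS1991, §1 Theorem and §5 Cor. 5.6] -/
theorem rung_5709e1_of_shaAn_unit (W : WeierstrassCurve ℚ) (hW : W = ⟨0, 1, 1, -107, 392⟩)
    [W.IsElliptic] [W.IsGloballyMinimal] [NeZero (W.conductorNorm ℤ)]
    -- published inputs (named facts of the tree)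
    (hGZ : ∀ (N : ℕ) [NeZero N] (W : WeierstrassCurve ℚ) (K : Type) [Field K] [NumberField K],
      gross_zagier N W K)
    (hKo : ∀ (N : ℕ) [NeZero N] (W : WeierstrassCurve ℚ) (K : Type) [Field K] [NumberField K],
      kolyvagin N W K)
    (hB : ∀ (N : ℕ) [NeZero N] (W : WeierstrassCurve ℚ) (K : Type) [Field K] [NumberField K],
      Kolyvagin1990_padicValNat_card_sha_le N W K)
    (hSk : Skinner2016.thmC_padicValRat_bsd_rank_zero)
    (hGZK : rank_eq_analyticRank_of_analyticRank_le_one) (hmod : hasEntireLFunction_rat)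
    (hnf : exists_isNewformOf) (hHL : HoffsteinLuo1997_exists_twist_L_one_ne_zero)
    (hMaz : mazur_not_dvd_maninConstant_of_odd)
    (hrec : ∀ (N : ℕ) [NeZero N] (W : WeierstrassCurve ℚ) (K : Type) [Field K] [NumberField K],
      heegnerPointOfConductor_one_galoisConj N W K)
    (h1 : ∀ (N : ℕ) [NeZero N] (W : WeierstrassCurve ℚ) (K : Type) [Field K] [NumberField K],
      phi_heegnerPointOfConductor_mem_range_map_ringClassField N W K)
    (h2 : ∀ (K : Type) [Field K] [NumberField K], exists_generator_ringClassGalOver K)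
    (hMcU : McCallum1991_padicValNat_card_sha_primary_add_le_of_globalDivisibility)
    -- the pair: analytic rank one
    (hr : W.analyticRank = 1)
    -- THE ATTESTED DATUM: the exact analytic order of Ш(E/ℚ) is a 3-adic unit
    {q : ℚ} (hq : shaAn W = (q : ℂ)) (hv : padicValRat 3 q ≤ 0)
    -- ANY Hoffstein–Luo frame of the curve
    (K : Type) [Field K] [NumberField K] (Dt : ModularParametrizationData W (W.conductorNorm ℤ)) (β : ℤ)
    (ι : K →+* ℂ) (hK : IsImaginaryQuadratic K) (hodd : Odd (NumberField.discr K))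
    (hH : SatisfiesHeegnerHypothesis (W.conductorNorm ℤ) K)
    (hLt : (W.quadraticTwist (NumberField.discr K : ℚ)).entireLFunction 1 ≠ 0)
    (hβ : (4 * (W.conductorNorm ℤ : ℤ)) ∣ β ^ 2 - NumberField.discr K) (hc : ¬ (3 : ℤ) ∣ Dt.c) :
    ∃ (n : ℕ) (d : KolyvaginHeegnerData Dt β ι n),
      KolyvaginDescent.KolSupp (Zhang2014.IsKolyvaginPrime (W.conductorNorm ℤ) W K 3) n ∧
        d.kolyvaginClass Nat.prime_three 1 ≠ 0 := by
  have htam : ¬ 3 ∣ W.tamagawaProduct := by rw [tamagawaProduct_eq_one W hW]; decide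
  exact kolyvaginClass_one_ne_zero_of_padicValRat_shaAn_le_zero_of_hlFrame W K Dt β ι hGZ hKo hB hSk hGZK hmod hnf
    hHL hMaz hrec h1 h2 hMcU (classX11b_three_of_analyticRank W hW hr) (ram_three W hW) htam hK hodd hH hLt hβ hc hq hv

end Summit.BirchSwinnertonDyer.Rank1Residual.X11b.Three.Koly.Rung5709e1

end
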